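import Summits.QuantumAdvantage.QuantumAdvantage.Theorems.SteerDialCylinder

/-!
# SteerDial (8): SteerDialRotList — ADAPTIVE (rotation-list) STEERING

Part 8 of the prover-side twin of the lineage decomp-qadv-lens-5 steering programme (route `SpreadDial`; W-piece item
stmt-QuantumAdvantage-30909 `AlgCover3`), generation 9, workshop node «TagDial» (sha256 9af4092b…, farm rc0 · 0 err ·
0 warn · 0 sorry).  Content verbatim from the node's §1 and §3, re-homed in the `Theorems.SteerDial` namespace on top of
the landed parts 1–4 (`SteerDialFold/Words/Level/Cylinder`).

THE THEOREM (`rotListSteer_of_polyLoss3`): `PolyLoss3 ⇒` for every window length `m ≥ 1` and list exponent `c₁`, with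
`k` = `PolyLoss3`'s exponent, every `c`, all large `n`, every strategy `P` and test `ψ` of degree `≤ (log₂(n+m))^c` on
`C_{n+m}` and EVERY certificate of `T ≤ (log₂ n)^c₁` candidates `(rₜ, uₜ, αₜ, βₜ, aₜ, bₜ)` with `wordCert`:
`2^n/n^k ≤ T·#({ψ = 1} ∩ Loss P) + #{y : ∀ t, ψ(pad uₜ (rot rₜ y)) ≠ 1}`.
The spliced strategy plays, at body `y`, the fold of `P` along the FIRST candidate whose steered pattern lands in
`{ψ = 1}`; the first-success selector is an algebraic partition of unity of degree `≤ (T+1)·2·deg ψ` (ADDITIVE in the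
list length), the per-candidate body rotation is a variable permutation (zero degree cost), losses pull back by
`rel_fold` + `RingSymmetry.rel_rot`, multiplicity `≤ T`.  No `def … : Prop`, no `instance`, no `notation`.
-/

set_option linter.style.longLine false
set_option linter.dupNamespace false

namespace Summit.QuantumAdvantage.QuantumAdvantage.Theorems.SteerDial

open Finset
open Literature.Computability.QuantumComplexity Literature.Computability.MetaComplexity
open Literature.Computability.QuantumComplexity.RingHLF
open Summit.QuantumAdvantage.AdviceFreeQNC0
open Summit.QuantumAdvantage.QuantumAdvantage.Theses

/-! ## §1  The AND-selector algebra (on top of the `ind`-calculus of `SteerDialWords`) -/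

section Indicator
variable {n : ℕ}

/-- SteerDial helper `ind_and` (lens-5 g7 SteerDial twin; see the enclosing section docstring). -/
theorem ind_and (f g : (Fin n → Bool) → Bool) : ind (fun y => f y && g y) = ind f * ind g := by
  funext y
  simp only [ind, Pi.mul_apply]
  have key : ∀ p q : Bool, (if (p && q) = true then (1 : ZMod 3) else 0) =
      (if p = true then (1 : ZMod 3) else 0) * (if q = true then (1 : ZMod 3) else 0) := by decide
  exact key (f y) (g y)

/-- SteerDial helper `ind_not_mem_lowDeg` (lens-5 g7 SteerDial twin; see the enclosing section docstring). -/
theorem ind_not_mem_lowDeg {d : ℕ} {f : (Fin n → Bool) → Bool} (hf : ind f ∈ Smolensky.lowDeg (ZMod 3) n d) :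
    ind (fun y => !f y) ∈ Smolensky.lowDeg (ZMod 3) n d := by
  have h : ind (fun y => !f y) = 1 - ind f := by
    funext y
    simp only [ind, Pi.sub_apply, Pi.one_apply]
    have key : ∀ p : Bool, (if (!p) = true then (1 : ZMod 3) else 0) = 1 - (if p = true then (1 : ZMod 3) else 0) := by
      decide
    exact key (f y)
  rw [h]
  exact Submodule.sub_mem _ (one_mem_lowDeg _) hf

/-- AND of a family of NEGATED bits of degree `≤ d` each has degree `≤ |S|·d` (the «no earlier success» selector);
stated for any Boolean function `F` with the right truth table, so that no `Decidable` instance is pinned. -/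
theorem ind_allFalse_mem_lowDeg {ι : Type*} [DecidableEq ι] (S : Finset ι) (Zb : ι → (Fin n → Bool) → Bool) (d : ℕ)
    (h : ∀ j ∈ S, ind (Zb j) ∈ Smolensky.lowDeg (ZMod 3) n d) (F : (Fin n → Bool) → Bool)
    (hF : ∀ y, F y = true ↔ ∀ j ∈ S, Zb j y = false) :
    ind F ∈ Smolensky.lowDeg (ZMod 3) n (S.card * d) := by
  induction S using Finset.induction_on generalizing F with
  | empty =>
    have hF' : F = fun _ => true := funext fun y => (hF y).2 (by simp)
    rw [hF']
    simpa using ind_const_mem_lowDeg (n := n) true 0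
  | @insert j S hj ih =>
    have hF' : F = fun y => (!Zb j y) && decide (∀ j' ∈ S, Zb j' y = false) := by
      funext y
      have hy := hF y
      rw [Finset.forall_mem_insert] at hy
      by_cases hQ : ∀ j' ∈ S, Zb j' y = false
      · cases hFy : F y <;> cases hZ : Zb j y <;> simp_all
      · cases hFy : F y <;> cases hZ : Zb j y <;> simp_all
    rw [hF', ind_and, Finset.card_insert_of_notMem hj, Nat.succ_mul, Nat.add_comm]
    exact Smolensky.mul_mem_lowDeg_add (ind_not_mem_lowDeg (h j (Finset.mem_insert_self _ _)))
      (ih (fun j' hj' => h j' (Finset.mem_insert_of_mem hj')) _ fun y => decide_eq_true_iff)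

end Indicator

/-! ## §2  ADAPTIVE (rotation-list) STEERING: `PolyLoss3 ⇒` loss inside `{ψ = 1}` up to the uncovered bodies — PROVED -/

section Steer
variable {n m T : ℕ}

/-- The inverse rotation amount: `r + rinv n r ≡ 0 (mod n)`. -/
def rinv (n r : ℕ) : ℕ := (n - 1) * r

/-- SteerDial helper `rot_rinv` (lens-5 g7 SteerDial twin; see the enclosing section docstring). -/
theorem rot_rinv (r : ℕ) (z : Fin n → Bool) : rot r (rot (rinv n r) z) = z := by
  rcases Nat.eq_zero_or_pos n with hn | hn
  · subst hn; funext i; exact i.elim0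
  · rw [RingSymmetry.rot_rot, rinv, show r + (n - 1) * r = n * r by
      calc r + (n - 1) * r = (n - 1 + 1) * r := by ring
        _ = n * r := by rw [Nat.sub_add_cancel hn]]
    exact RingSymmetry.rot_mul_self r z

/-- The steered pattern of candidate `t` at body `y`: rotate the body by `rₜ`, then pad with the word `uₜ`. -/
def steerPt (r : Fin T → ℕ) (u : Fin T → Fin m → Bool) (t : Fin T) (y : Fin n → Bool) : Fin (n + m) → Bool :=
  pad (u t) (rot (r t) y)

/-- SteerDial helper `steerPt_injective` (lens-5 g7 SteerDial twin; see the enclosing section docstring). -/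
theorem steerPt_injective (r : Fin T → ℕ) (u : Fin T → Fin m → Bool) (t : Fin T) :
    Function.Injective (steerPt (n := n) r u t) := by
  intro y y' h
  apply RingSymmetry.rot_injective (r t)
  funext i
  have := congrFun h (Fin.castAdd m i)
  simpa [steerPt, pad_castAdd] using this

/-- Candidate `t` is GOOD for body `y`: its steered pattern lies in the test event `{ψ = 1}`. -/
def good (ψ : Smolensky.CubeFn (ZMod 3) (n + m)) (r : Fin T → ℕ) (u : Fin T → Fin m → Bool) (t : Fin T)
    (y : Fin n → Bool) : Bool :=
  decide (ψ (steerPt r u t y) = 1)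

/-- No candidate before `t` is good for `y`. -/
def noneBefore (ψ : Smolensky.CubeFn (ZMod 3) (n + m)) (r : Fin T → ℕ) (u : Fin T → Fin m → Bool) (t : Fin T)
    (y : Fin n → Bool) : Bool :=
  decide (∀ t' ∈ (univ.filter fun t' : Fin T => t' < t), good ψ r u t' y = false)

/-- `t` is the FIRST good candidate for `y`. -/
def firstGood (ψ : Smolensky.CubeFn (ZMod 3) (n + m)) (r : Fin T → ℕ) (u : Fin T → Fin m → Bool) (t : Fin T)
    (y : Fin n → Bool) : Bool :=
  good ψ r u t y && noneBefore ψ r u t y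

/-- SteerDial helper `good_of_firstGood` (lens-5 g7 SteerDial twin; see the enclosing section docstring). -/
theorem good_of_firstGood {ψ : Smolensky.CubeFn (ZMod 3) (n + m)} {r : Fin T → ℕ} {u : Fin T → Fin m → Bool}
    {t : Fin T} {y : Fin n → Bool} (h : firstGood ψ r u t y = true) : ψ (steerPt r u t y) = 1 := by
  unfold firstGood at h
  rw [Bool.and_eq_true] at h
  exact of_decide_eq_true (p := ψ (steerPt r u t y) = 1) h.1

/-- SteerDial helper `firstGood_unique` (lens-5 g7 SteerDial twin; see the enclosing section docstring). -/
theorem firstGood_unique {ψ : Smolensky.CubeFn (ZMod 3) (n + m)} {r : Fin T → ℕ} {u : Fin T → Fin m → Bool}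
    {t t' : Fin T} {y : Fin n → Bool} (h : firstGood ψ r u t y = true) (h' : firstGood ψ r u t' y = true) :
    t = t' := by
  unfold firstGood noneBefore at h h'
  rw [Bool.and_eq_true, decide_eq_true_eq] at h h'
  rcases lt_trichotomy t t' with hlt | heq | hgt
  · have := h'.2 t (Finset.mem_filter.2 ⟨mem_univ _, hlt⟩)
    rw [h.1] at this
    exact absurd this (by decide)
  · exact heq
  · have := h.2 t' (Finset.mem_filter.2 ⟨mem_univ _, hgt⟩)
    rw [h'.1] at this
    exact absurd this (by decide)

/-- SteerDial helper `exists_firstGood` (lens-5 g7 SteerDial twin; see the enclosing section docstring). -/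
theorem exists_firstGood {ψ : Smolensky.CubeFn (ZMod 3) (n + m)} {r : Fin T → ℕ} {u : Fin T → Fin m → Bool}
    {y : Fin n → Bool} (h : ∃ t, good ψ r u t y = true) : ∃ t₀, firstGood ψ r u t₀ y = true := by
  classical
  obtain ⟨t₁, ht₁⟩ := h
  obtain ⟨t₀, ht₀, hmin⟩ := Finset.exists_min_image (univ.filter fun t : Fin T => good ψ r u t y = true)
    (fun t => t.val) ⟨t₁, Finset.mem_filter.2 ⟨mem_univ _, ht₁⟩⟩
  refine ⟨t₀, ?_⟩
  unfold firstGood noneBefore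
  rw [Bool.and_eq_true, decide_eq_true_eq]
  refine ⟨(Finset.mem_filter.1 ht₀).2, fun t' ht' => ?_⟩
  have hlt : t' < t₀ := (Finset.mem_filter.1 ht').2
  cases hg : good ψ r u t' y
  · rfl
  · have := hmin t' (Finset.mem_filter.2 ⟨mem_univ _, hg⟩)
    exact absurd hlt (not_lt.2 (Fin.le_def.2 this))

/-- Degree of the success bit of one candidate: `2·deg ψ` (substitution by a padded, rotated body). -/
theorem ind_good_mem_lowDeg {d : ℕ} {ψ : Smolensky.CubeFn (ZMod 3) (n + m)}
    (hψ : ψ ∈ Smolensky.lowDeg (ZMod 3) (n + m) d) (r : Fin T → ℕ) (u : Fin T → Fin m → Bool) (t : Fin T) :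
    ind (good ψ r u t) ∈ Smolensky.lowDeg (ZMod 3) n (2 * d) := by
  have h1 : (fun y : Fin n → Bool => ψ (steerPt r u t y)) ∈ Smolensky.lowDeg (ZMod 3) n d :=
    Smolensky.comp_subst_mem_lowDeg (fun y : Fin n → Bool => rot (r t) y)
      (fun i => Or.inr ⟨RingSymmetry.shift n (r t) i, fun _ => rfl⟩) (comp_pad_mem_lowDegG (u t) hψ)
  exact ind_decide_mem_lowDeg h1

/-- Degree of the first-success selector: `(T+1)·2·deg ψ` — ADDITIVE in the list length. -/
theorem ind_firstGood_mem_lowDeg {d : ℕ} {ψ : Smolensky.CubeFn (ZMod 3) (n + m)}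
    (hψ : ψ ∈ Smolensky.lowDeg (ZMod 3) (n + m) d) (r : Fin T → ℕ) (u : Fin T → Fin m → Bool) (t : Fin T) :
    ind (firstGood ψ r u t) ∈ Smolensky.lowDeg (ZMod 3) n ((T + 1) * (2 * d)) := by
  have hsel := ind_allFalse_mem_lowDeg (n := n) (univ.filter fun t' : Fin T => t' < t) (fun t' => good ψ r u t')
    (2 * d) (fun t' _ => ind_good_mem_lowDeg hψ r u t') (noneBefore ψ r u t) fun y => by
      unfold noneBefore
      exact decide_eq_true_iff
  have hprod : ind (firstGood ψ r u t) = ind (good ψ r u t) * ind (noneBefore ψ r u t) := by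
    rw [← ind_and]
    rfl
  rw [hprod, show (T + 1) * (2 * d) = 2 * d + T * (2 * d) by ring]
  refine Smolensky.mul_mem_lowDeg_add (ind_good_mem_lowDeg hψ r u t) (Smolensky.lowDeg_mono ?_ hsel)
  exact Nat.mul_le_mul_right _ ((Finset.card_filter_le _ _).trans (by simp))

/-- The steered CANDIDATE strategy `t`: the fold of `P` along `uₜ`, computed on the rotated body and rotated back. -/
def cand (r : Fin T → ℕ) (u α β : Fin T → Fin m → Bool) (a b : Fin T → Bool)
    (P : Fin (n + m) → Smolensky.CubeFn (ZMod 3) (n + m)) (t : Fin T) (i : Fin n) : Smolensky.CubeFn (ZMod 3) n :=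
  fun y => wfoldG (u t) (α t) (β t) (a t) (b t) P (RingSymmetry.shift n (rinv n (r t)) i) (rot (r t) y)

/-- SteerDial helper `cand_mem_lowDeg` (lens-5 g7 SteerDial twin; see the enclosing section docstring). -/
theorem cand_mem_lowDeg {d : ℕ} (r : Fin T → ℕ) (u α β : Fin T → Fin m → Bool) (a b : Fin T → Bool)
    {P : Fin (n + m) → Smolensky.CubeFn (ZMod 3) (n + m)} (hP : ∀ b', P b' ∈ Smolensky.lowDeg (ZMod 3) (n + m) d)
    (t : Fin T) (i : Fin n) : cand r u α β a b P t i ∈ Smolensky.lowDeg (ZMod 3) n ((2 * m + 2) * d) :=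
  Smolensky.comp_subst_mem_lowDeg (fun y : Fin n → Bool => rot (r t) y)
    (fun i' => Or.inr ⟨RingSymmetry.shift n (r t) i', fun _ => rfl⟩)
    (ind_foldBitG_mem_lowDeg (u t) (α t) (β t) (a t) (b t) hP _)

/-- The folded output of candidate `t` at body `y`, in the body's own frame. -/
def candOut (r : Fin T → ℕ) (u α β : Fin T → Fin m → Bool) (a b : Fin T → Bool)
    (P : Fin (n + m) → Smolensky.CubeFn (ZMod 3) (n + m)) (t : Fin T) (y : Fin n → Bool) : Fin n → Bool :=
  rot (rinv n (r t)) (foldOut n (α t) (β t) (a t) (b t) (bits P (steerPt r u t y)))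

/-- SteerDial helper `cand_bits` (lens-5 g7 SteerDial twin; see the enclosing section docstring). -/
theorem cand_bits (r : Fin T → ℕ) (u α β : Fin T → Fin m → Bool) (a b : Fin T → Bool)
    (P : Fin (n + m) → Smolensky.CubeFn (ZMod 3) (n + m)) (t : Fin T) (y : Fin n → Bool) (i : Fin n) :
    decide (cand r u α β a b P t i y = 1) = candOut r u α β a b P t y i := by
  unfold cand candOut
  have h := congrFun (wfoldG_bits (u t) (α t) (β t) (a t) (b t) P (rot (r t) y)) (RingSymmetry.shift n (rinv n (r t)) i)
  exact h

/-- **The rotation-list splice**: at body `y` play the FIRST good candidate's steered fold (and `0` if none is good). -/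
def spliceRL (ψ : Smolensky.CubeFn (ZMod 3) (n + m)) (r : Fin T → ℕ) (u α β : Fin T → Fin m → Bool) (a b : Fin T → Bool)
    (P : Fin (n + m) → Smolensky.CubeFn (ZMod 3) (n + m)) : Fin n → Smolensky.CubeFn (ZMod 3) n :=
  fun i => ∑ t : Fin T, ind (firstGood ψ r u t) * cand r u α β a b P t i

/-- Degree of the splice: `(T+1)·2d + (2m+2)·d`. -/
theorem spliceRL_mem_lowDeg {d : ℕ} {ψ : Smolensky.CubeFn (ZMod 3) (n + m)} (hψ : ψ ∈ Smolensky.lowDeg (ZMod 3) (n + m) d)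
    (r : Fin T → ℕ) (u α β : Fin T → Fin m → Bool) (a b : Fin T → Bool)
    {P : Fin (n + m) → Smolensky.CubeFn (ZMod 3) (n + m)} (hP : ∀ b', P b' ∈ Smolensky.lowDeg (ZMod 3) (n + m) d) (i : Fin n) :
    spliceRL ψ r u α β a b P i ∈ Smolensky.lowDeg (ZMod 3) n ((T + 1) * (2 * d) + (2 * m + 2) * d) := by
  unfold spliceRL
  exact Submodule.sum_mem _ fun t _ =>
    Smolensky.mul_mem_lowDeg_add (ind_firstGood_mem_lowDeg hψ r u t) (cand_mem_lowDeg r u α β a b hP t i)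

/-- On a body with a first good candidate `t₀`, the splice IS candidate `t₀`. -/
theorem spliceRL_apply {ψ : Smolensky.CubeFn (ZMod 3) (n + m)} {r : Fin T → ℕ} {u : Fin T → Fin m → Bool}
    (α β : Fin T → Fin m → Bool) (a b : Fin T → Bool) (P : Fin (n + m) → Smolensky.CubeFn (ZMod 3) (n + m))
    {t₀ : Fin T} {y : Fin n → Bool} (h : firstGood ψ r u t₀ y = true) (i : Fin n) :
    spliceRL ψ r u α β a b P i y = cand r u α β a b P t₀ i y := by
  unfold spliceRL
  rw [Finset.sum_apply, Fintype.sum_eq_single t₀]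
  · rw [Pi.mul_apply, show ind (firstGood ψ r u t₀) y = 1 by simp [ind, h], one_mul]
  · intro t ht
    have hf : firstGood ψ r u t y = false := by
      cases hft : firstGood ψ r u t y
      · rfl
      · exact absurd (firstGood_unique hft h) ht
    rw [Pi.mul_apply, show ind (firstGood ψ r u t) y = 0 by simp [ind, hf], zero_mul]

/-- SteerDial helper `spliceRL_bits` (lens-5 g7 SteerDial twin; see the enclosing section docstring). -/
theorem spliceRL_bits {ψ : Smolensky.CubeFn (ZMod 3) (n + m)} {r : Fin T → ℕ} {u : Fin T → Fin m → Bool}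
    (α β : Fin T → Fin m → Bool) (a b : Fin T → Bool) (P : Fin (n + m) → Smolensky.CubeFn (ZMod 3) (n + m))
    {t₀ : Fin T} {y : Fin n → Bool} (h : firstGood ψ r u t₀ y = true) :
    (fun i => decide (spliceRL ψ r u α β a b P i y = 1)) = candOut r u α β a b P t₀ y := by
  funext i
  rw [spliceRL_apply α β a b P h i, cand_bits]

/-- **Loss transport**: a loss of the splice at a body with first good candidate `t₀` is a loss of `P` at the steered
pattern (identity-word fold law `rel_fold` + rotation covariance `rel_rot`). -/
theorem loss_transportRL (hn : 3 ≤ n) (hm : 1 ≤ m) {ψ : Smolensky.CubeFn (ZMod 3) (n + m)} {r : Fin T → ℕ}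
    {u α β : Fin T → Fin m → Bool} {a b : Fin T → Bool} (cert : ∀ t, wordCert (u t) (α t) (β t) (a t) (b t) = true)
    (P : Fin (n + m) → Smolensky.CubeFn (ZMod 3) (n + m)) {t₀ : Fin T} {y : Fin n → Bool}
    (h : firstGood ψ r u t₀ y = true) (hloss : ¬ RingHLF.Rel y (fun i => decide (spliceRL ψ r u α β a b P i y = 1))) :
    ¬ RingHLF.Rel (steerPt r u t₀ y) (bits P (steerPt r u t₀ y)) := by
  intro hwin
  apply hloss
  rw [spliceRL_bits α β a b P h]
  unfold candOut
  have hfold := rel_fold hn hm (cert t₀) (rot (r t₀) y) (bits P (steerPt r u t₀ y)) hwin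
  have hrot := (RingSymmetry.rel_rot (r t₀) y
    (rot (rinv n (r t₀)) (foldOut n (α t₀) (β t₀) (a t₀) (b t₀) (bits P (steerPt r u t₀ y))))).1
  rw [rot_rinv] at hrot
  exact hrot hfold

/-- **Loss count**: `#Loss(splice) ≤ T · #({ψ = 1} ∩ Loss P) + #Bad`. -/
theorem card_loss_spliceRL_le (hn : 3 ≤ n) (hm : 1 ≤ m) (ψ : Smolensky.CubeFn (ZMod 3) (n + m)) (r : Fin T → ℕ)
    {u α β : Fin T → Fin m → Bool} {a b : Fin T → Bool} (cert : ∀ t, wordCert (u t) (α t) (β t) (a t) (b t) = true)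
    (P : Fin (n + m) → Smolensky.CubeFn (ZMod 3) (n + m)) :
    (univ.filter fun y : Fin n → Bool => ¬ RingHLF.Rel y (fun i => decide (spliceRL ψ r u α β a b P i y = 1))).card ≤
      T * (univ.filter fun x : Fin (n + m) → Bool => ψ x = 1 ∧ ¬ RingHLF.Rel x (fun b' => decide (P b' x = 1))).card +
        (univ.filter fun y : Fin n → Bool => ∀ t : Fin T, ψ (pad (u t) (rot (r t) y)) ≠ 1).card := by
  classical
  set L := univ.filter fun y : Fin n → Bool => ¬ RingHLF.Rel y (fun i => decide (spliceRL ψ r u α β a b P i y = 1))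
  set EL := univ.filter fun x : Fin (n + m) → Bool => ψ x = 1 ∧ ¬ RingHLF.Rel x (fun b' => decide (P b' x = 1))
  set Bad := univ.filter fun y : Fin n → Bool => ∀ t : Fin T, ψ (pad (u t) (rot (r t) y)) ≠ 1
  set A : Fin T → Finset (Fin n → Bool) := fun t =>
    univ.filter fun y => firstGood ψ r u t y = true ∧ ¬ RingHLF.Rel (steerPt r u t y) (bits P (steerPt r u t y))
  have hsub : L ⊆ Bad ∪ (univ : Finset (Fin T)).biUnion A := by
    intro y hy
    rw [Finset.mem_filter] at hy
    rw [Finset.mem_union]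
    by_cases hg : ∃ t, good ψ r u t y = true
    · obtain ⟨t₀, ht₀⟩ := exists_firstGood hg
      refine Or.inr (Finset.mem_biUnion.2 ⟨t₀, mem_univ _, Finset.mem_filter.2 ⟨mem_univ _, ht₀, ?_⟩⟩)
      exact loss_transportRL hn hm cert P ht₀ hy.2
    · refine Or.inl (Finset.mem_filter.2 ⟨mem_univ _, fun t hψt => hg ⟨t, ?_⟩⟩)
      unfold good steerPt
      exact decide_eq_true hψt
  have hA : ∀ t, (A t).card ≤ EL.card := fun t => by
    refine Finset.card_le_card_of_injOn (steerPt r u t) (fun y hy => ?_) (fun y _ y' _ hyy => steerPt_injective r u t hyy)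
    rw [Finset.mem_coe, Finset.mem_filter] at hy ⊢
    exact ⟨mem_univ _, good_of_firstGood hy.2.1, hy.2.2⟩
  calc L.card ≤ (Bad ∪ (univ : Finset (Fin T)).biUnion A).card := Finset.card_le_card hsub
    _ ≤ Bad.card + ((univ : Finset (Fin T)).biUnion A).card := Finset.card_union_le _ _
    _ ≤ Bad.card + ∑ t, (A t).card := Nat.add_le_add_left Finset.card_biUnion_le _
    _ ≤ Bad.card + ∑ _t : Fin T, EL.card := Nat.add_le_add_left (Finset.sum_le_sum fun t _ => hA t) _
    _ = T * EL.card + Bad.card := by rw [Finset.sum_const, Finset.card_univ, Fintype.card_fin, smul_eq_mul]; ring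

/-- Degree budget of the splice: `((T+1)·2 + 2m + 2)·(log₂(n+m))^c ≤ (log₂ n)^(2c + c₁ + 2)` for `n ≥ 2^(2m+4)`,
`T ≤ (log₂ n)^c₁`. -/
theorem degree_budgetRL (m c c₁ : ℕ) : ∀ n ≥ 2 ^ (2 * m + 4), ∀ T ≤ (Nat.log 2 n) ^ c₁,
    (T + 1) * (2 * (Nat.log 2 (n + m)) ^ c) + (2 * m + 2) * (Nat.log 2 (n + m)) ^ c ≤ (Nat.log 2 n) ^ (2 * c + c₁ + 2) := by
  intro n hn T hT
  set L := Nat.log 2 n with hL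
  have hLm : 2 * m + 4 ≤ L := Nat.le_log_of_pow_le (by norm_num) hn
  have hL2 : 2 ≤ L := by omega
  have hmn : m ≤ n := by
    have h1 : m < 2 ^ m := Nat.lt_two_pow_self
    have h2 : 2 ^ m ≤ 2 ^ (2 * m + 4) := Nat.pow_le_pow_right (by norm_num) (by omega)
    omega
  have hn0 : n ≠ 0 := by
    have h := @Nat.one_le_two_pow (2 * m + 4)
    omega
  have hlog : Nat.log 2 (n + m) ≤ L + 1 := by
    calc Nat.log 2 (n + m) ≤ Nat.log 2 (n * 2) := Nat.log_mono_right (by omega)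
      _ = L + 1 := by rw [Nat.log_mul_base (by norm_num) hn0]
  have h1 : (Nat.log 2 (n + m)) ^ c ≤ L ^ (2 * c) := by
    calc (Nat.log 2 (n + m)) ^ c ≤ (L + 1) ^ c := Nat.pow_le_pow_left hlog c
      _ ≤ (2 * L) ^ c := Nat.pow_le_pow_left (by omega) c
      _ = 2 ^ c * L ^ c := by rw [Nat.mul_pow]
      _ ≤ L ^ c * L ^ c := Nat.mul_le_mul_right _ (Nat.pow_le_pow_left (by omega) c)
      _ = L ^ (2 * c) := by rw [← pow_add, two_mul]
  have hT2 : 2 * T ≤ L ^ (c₁ + 1) := by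
    calc 2 * T ≤ 2 * L ^ c₁ := Nat.mul_le_mul_left _ hT
      _ ≤ L * L ^ c₁ := Nat.mul_le_mul_right _ hL2
      _ = L ^ (c₁ + 1) := by ring
  have hm2 : 2 * m + 4 ≤ L ^ (c₁ + 1) := hLm.trans (Nat.le_self_pow (by omega) L)
  have hsum : 2 * T + 2 * m + 4 ≤ L ^ (c₁ + 2) := by
    calc 2 * T + 2 * m + 4 ≤ L ^ (c₁ + 1) + L ^ (c₁ + 1) := by omega
      _ = 2 * L ^ (c₁ + 1) := by ring
      _ ≤ L * L ^ (c₁ + 1) := Nat.mul_le_mul_right _ hL2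
      _ = L ^ (c₁ + 2) := by ring
  calc (T + 1) * (2 * (Nat.log 2 (n + m)) ^ c) + (2 * m + 2) * (Nat.log 2 (n + m)) ^ c
      = (2 * T + 2 * m + 4) * (Nat.log 2 (n + m)) ^ c := by ring
    _ ≤ L ^ (c₁ + 2) * L ^ (2 * c) := Nat.mul_le_mul hsum h1
    _ = L ^ (2 * c + c₁ + 2) := by ring

/-- **ADAPTIVE STEERING (PROVED from `PolyLoss3`).**  For every window length `m ≥ 1` and list-size exponent `c₁`
there is `k` (namely `PolyLoss3`'s own exponent) such that for every degree exponent `c`, all large `n`, every strategy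
`P` and test `ψ` of degree `≤ (log₂(n+m))^c` on `C_{n+m}`, and EVERY certificate — `T ≤ (log₂ n)^c₁` candidates
`(rₜ, uₜ, αₜ, βₜ, aₜ, bₜ)` with `wordCert` — :
`2^n / n^k ≤ T · #({ψ = 1} ∩ Loss P) + #{y : ∀ t, ψ (pad uₜ (rot rₜ y)) ≠ 1}`. -/
theorem rotListSteer_of_polyLoss3 (hP : SpreadDial.PolyLoss3) :
    ∃ k : ℕ, ∀ m : ℕ, 1 ≤ m → ∀ c₁ c : ℕ, ∃ n₀ : ℕ, ∀ n ≥ n₀, ∀ P : Fin (n + m) → Smolensky.CubeFn (ZMod 3) (n + m),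
      (∀ b, P b ∈ Smolensky.lowDeg (ZMod 3) (n + m) ((Nat.log 2 (n + m)) ^ c)) →
        ∀ ψ : Smolensky.CubeFn (ZMod 3) (n + m), ψ ∈ Smolensky.lowDeg (ZMod 3) (n + m) ((Nat.log 2 (n + m)) ^ c) →
          ∀ T : ℕ, T ≤ (Nat.log 2 n) ^ c₁ → ∀ r : Fin T → ℕ, ∀ u α β : Fin T → Fin m → Bool, ∀ a b : Fin T → Bool,
            (∀ t, wordCert (u t) (α t) (β t) (a t) (b t) = true) →
              1 / (n : ℝ) ^ k * (2 : ℝ) ^ n ≤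
                (T : ℝ) * ((univ.filter fun x : Fin (n + m) → Bool =>
                    ψ x = 1 ∧ ¬ RingHLF.Rel x (fun b' => decide (P b' x = 1))).card : ℝ) +
                  ((univ.filter fun y : Fin n → Bool => ∀ t : Fin T, ψ (pad (u t) (rot (r t) y)) ≠ 1).card : ℝ) := by
  obtain ⟨k, hk⟩ := hP
  refine ⟨k, fun m hm c₁ c => ?_⟩
  obtain ⟨n₀, hn₀⟩ := hk (2 * c + c₁ + 2)
  refine ⟨max n₀ (2 ^ (2 * m + 4)), fun n hn P hPdeg ψ hψ T hT r u α β a b cert => ?_⟩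
  have hn₀' : n₀ ≤ n := le_trans (le_max_left _ _) hn
  have hnM : 2 ^ (2 * m + 4) ≤ n := le_trans (le_max_right _ _) hn
  have hn3 : 3 ≤ n := by
    have : 2 ^ 4 ≤ 2 ^ (2 * m + 4) := Nat.pow_le_pow_right (by norm_num) (by omega)
    omega
  set S := spliceRL ψ r u α β a b P with hS
  have hSdeg : ∀ i, S i ∈ Smolensky.lowDeg (ZMod 3) n ((Nat.log 2 n) ^ (2 * c + c₁ + 2)) := fun i =>
    Smolensky.lowDeg_mono (degree_budgetRL m c c₁ n hnM T hT) (spliceRL_mem_lowDeg hψ r u α β a b hPdeg i)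
  have hwin := hn₀ n hn₀' S hSdeg
  have hsum := card_win_add_card_loss (fun y : Fin n → Bool => RingHLF.Rel y (fun i => decide (S i y = 1)))
  have hloss : 1 / (n : ℝ) ^ k * (2 : ℝ) ^ n ≤
      ((univ.filter fun y : Fin n → Bool => ¬ RingHLF.Rel y (fun i => decide (S i y = 1))).card : ℝ) := by
    have e : (1 - 1 / (n : ℝ) ^ k) * (2 : ℝ) ^ n = (2 : ℝ) ^ n - 1 / (n : ℝ) ^ k * (2 : ℝ) ^ n := by ring
    linarith
  have htr := card_loss_spliceRL_le hn3 hm ψ r cert P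
  have htr' : ((univ.filter fun y : Fin n → Bool => ¬ RingHLF.Rel y (fun i => decide (S i y = 1))).card : ℝ) ≤
      (T : ℝ) * ((univ.filter fun x : Fin (n + m) → Bool =>
          ψ x = 1 ∧ ¬ RingHLF.Rel x (fun b' => decide (P b' x = 1))).card : ℝ) +
        ((univ.filter fun y : Fin n → Bool => ∀ t : Fin T, ψ (pad (u t) (rot (r t) y)) ≠ 1).card : ℝ) := by
    exact_mod_cast htr
  exact hloss.trans htr'

end Steer

end Summit.QuantumAdvantage.QuantumAdvantage.Theorems.SteerDial
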